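import Literature.NumberTheory.EllipticCurves.FormalGroupNilIdealPointsAdd
import HarnessLib

/-!
# The formal group computes `E₁(K)`, III: the tangent case, `P(u) + P(v) = P(F_W(u, v))` for all `u, v`, and the
# group isomorphism `Ŵ(𝔪_K) ≃ E₁(K)` (Silverman AEC VII.2.2 over every complete ultrametric field)

Topic `Literature/NumberTheory/EllipticCurves`; sequel of `FormalGroupNilIdealPoints`, `FormalGroupNilIdealPointsAdd`
(notation from there). Port to the `LubinTate` evaluation layer of `Summits/…/Rank1Residual/Additive/FormalGroupBallPointsAddII`
(same proofs), using the ring-general duplication identities `formalXMulSq_formalMul_two'/twoY'`: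

* §1 `evF_self` (`F(t,t) = [2](t)`), the duplication identities at `t` (`doubleX_at`, `doubleY_at`) and
  **`ptOfZ_add_self`: `P(t) + P(t) = P(F_W(t, t))`** (no hypothesis on the characteristic: the `2`-torsion sub-case
  `P(t) = −P(t)` gives `t = i(t)`, `F(t, i(t)) = 0`).
* §2 **`ptOfZ_add`: `P(u) + P(v) = P(F_W(u, v))` for all `u, v ∈ 𝔪_K`**; **`zCoord_add`**: `z(P + Q) = F_W(z(P), z(Q))` on
  `E₁(K)`.
* §3 **the group isomorphism**: `ptHom W K : Ŵ(𝔪_K) = W.Pt (ballNilIdeal K) →+ E(K)` (injective, image `E₁(K)` =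
  `FormalGroupChart.kernel`), `kernelEquivPt : E₁(K) ≃+ Ŵ(𝔪_K)`, and **`zPt_nsmul`: `z(n • P) = [n]_W(z(P))`** on `E₁(K)`
  (`WeierstrassCurve.Pt.val_nsmul`) — the input of the Tate-module matching `T_pE ⊇ T_p(E₁) ≅ T_pŴ`.

BSD / K★ (`Cruxes/StarredOptimalManinUnitFiveSeven/Lines/kato-lever-hDR-sector-iii-periods.md` §5 (M1)): infrastructure;
nothing about elliptic curves over number fields is proved here.

## References
* J. H. Silverman, *The Arithmetic of Elliptic Curves* (2009), III.2.3, IV.1–IV.2, Prop. VII.2.2. [SilvermanAEC2009]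
* J.-P. Serre, *Local class field theory*, Cassels–Fröhlich Ch. VI §3.2. [CasselsFrohlichANT1967]
-/

noncomputable section

open scoped Classical NNReal
open PowerSeries

namespace Literature.NumberTheory.EllipticCurves

open Literature.NumberTheory.GaloisRepresentations.LubinTate
open Literature.NumberTheory.EllipticCurves.FormalGroupChart _root_.WeierstrassCurve

variable {A : Type*} [CommRing A] [UniformSpace A] [DiscreteUniformity A]
  {K : Type*} [NontriviallyNormedField K] [IsUltrametricDist K] [CompleteSpace K]
  [Algebra A (unitBall K)] [ContinuousSMul A (unitBall K)] {W : WeierstrassCurve A}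

/-! ## §1 The tangent case -/

/-- **`F(t, t) = [2]_W(t)`** at points (`2 • P = [2]_W P` in `Ŵ(𝔪_K)`). [cite: SilvermanAEC2009, IV.2] -/
theorem evF_self (t : (ballNilIdeal K).toIdeal) :
    evF W t t = evalPt₁ (ballNilIdeal K) (W.formalMul 2) (W.constantCoeff_formalMul 2) t := by
  rw [evF_eq_add, ← two_nsmul, WeierstrassCurve.Pt.val_nsmul]

/-- Dictionary: `X([2](t)) = (X ∘ [2])(t)`. [cite: CasselsFrohlichANT1967, Ch. VI §3.2] -/
theorem evX_evF_self (t : (ballNilIdeal K).toIdeal) :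
    evX W (evF W t t) = ((evalAt (ballNilIdeal K) t (W.formalXMulSq.subst (W.formalMul 2)) : unitBall K) : K) := by
  rw [evX, evF_self, evalAt_subst₁ t (W.formalMul 2) (W.constantCoeff_formalMul 2)]

/-- Dictionary: `[2](t)` in `K`. [cite: CasselsFrohlichANT1967, Ch. VI §3.2] -/
theorem coe_evF_self (t : (ballNilIdeal K).toIdeal) :
    (((evF W t t : (ballNilIdeal K).toIdeal) : unitBall K) : K) = ((evalAt (ballNilIdeal K) t (W.formalMul 2) : unitBall K) : K) := by
  rw [evF_self]; rfl

/-- **The duplication identity for `x`, at `t`** (`formalXMulSq_formalMul_two'` evaluated; `X = X(t)`, `D = [2](t)`, `s = t`).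
[cite: SilvermanAEC2009, IV.2] -/
theorem doubleX_at (t : (ballNilIdeal K).toIdeal) :
    evX W (evalPt₁ (ballNilIdeal K) (W.formalMul 2) (W.constantCoeff_formalMul 2) t) * ((t : unitBall K) : K) ^ 2 *
        ((cK K W.a₁ * ((t : unitBall K) : K) - 2) * evX W t + cK K W.a₃ * ((t : unitBall K) : K) ^ 3) ^ 2 =
      ((evalAt (ballNilIdeal K) t (W.formalMul 2) : unitBall K) : K) ^ 2 *
        ((3 * evX W t ^ 2 + 2 * cK K W.a₂ * ((t : unitBall K) : K) ^ 2 * evX W t + cK K W.a₄ * ((t : unitBall K) : K) ^ 4 +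
              cK K W.a₁ * ((t : unitBall K) : K) * evX W t) ^ 2 +
            cK K W.a₁ * (3 * evX W t ^ 2 + 2 * cK K W.a₂ * ((t : unitBall K) : K) ^ 2 * evX W t +
              cK K W.a₄ * ((t : unitBall K) : K) ^ 4 + cK K W.a₁ * ((t : unitBall K) : K) * evX W t) * ((t : unitBall K) : K) *
              ((cK K W.a₁ * ((t : unitBall K) : K) - 2) * evX W t + cK K W.a₃ * ((t : unitBall K) : K) ^ 3) -
          cK K W.a₂ * ((t : unitBall K) : K) ^ 2 *
            ((cK K W.a₁ * ((t : unitBall K) : K) - 2) * evX W t + cK K W.a₃ * ((t : unitBall K) : K) ^ 3) ^ 2 -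
          2 * evX W t * ((cK K W.a₁ * ((t : unitBall K) : K) - 2) * evX W t + cK K W.a₃ * ((t : unitBall K) : K) ^ 3) ^ 2) := by
  have h := congrArg (evalAt (ballNilIdeal K) t) W.formalXMulSq_formalMul_two'
  simp only [map_mul, map_pow, map_add, map_sub, map_ofNat, evalAt_X', evalAt_C'] at h
  rw [evalAt_subst₁ t (W.formalMul 2) (W.constantCoeff_formalMul 2)] at h
  have h' := congrArg Subtype.val h
  simp only [Subring.coe_mul, SubmonoidClass.coe_pow, Subring.coe_add, AddSubgroupClass.coe_sub] at h'
  exact h'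

/-- **The duplication identity for `y`, at `t`** (`formalXMulSq_formalMul_twoY'` evaluated). [cite: SilvermanAEC2009, IV.2] -/
theorem doubleY_at (t : (ballNilIdeal K).toIdeal) :
    (-evX W (evalPt₁ (ballNilIdeal K) (W.formalMul 2) (W.constantCoeff_formalMul 2) t) + cK K W.a₁ * evX W (evalPt₁ (ballNilIdeal K) (W.formalMul 2) (W.constantCoeff_formalMul 2) t) * ((evalAt (ballNilIdeal K) t (W.formalMul 2) : unitBall K) : K) +
          cK K W.a₃ * ((evalAt (ballNilIdeal K) t (W.formalMul 2) : unitBall K) : K) ^ 3) *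
        ((t : unitBall K) : K) ^ 3 * ((cK K W.a₁ * ((t : unitBall K) : K) - 2) * evX W t + cK K W.a₃ * ((t : unitBall K) : K) ^ 3) =
      -((3 * evX W t ^ 2 + 2 * cK K W.a₂ * ((t : unitBall K) : K) ^ 2 * evX W t + cK K W.a₄ * ((t : unitBall K) : K) ^ 4 +
              cK K W.a₁ * ((t : unitBall K) : K) * evX W t) *
          (evX W (evalPt₁ (ballNilIdeal K) (W.formalMul 2) (W.constantCoeff_formalMul 2) t) * ((t : unitBall K) : K) ^ 2 -
            evX W t * ((evalAt (ballNilIdeal K) t (W.formalMul 2) : unitBall K) : K) ^ 2) *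
          ((evalAt (ballNilIdeal K) t (W.formalMul 2) : unitBall K) : K)) +
        evX W t * ((evalAt (ballNilIdeal K) t (W.formalMul 2) : unitBall K) : K) ^ 3 *
          ((cK K W.a₁ * ((t : unitBall K) : K) - 2) * evX W t + cK K W.a₃ * ((t : unitBall K) : K) ^ 3) := by
  have h := congrArg (evalAt (ballNilIdeal K) t) W.formalXMulSq_formalMul_twoY'
  simp only [map_mul, map_pow, map_add, map_sub, map_neg, map_ofNat, evalAt_X', evalAt_C'] at h
  rw [evalAt_subst₁ t (W.formalMul 2) (W.constantCoeff_formalMul 2)] at h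
  have h' := congrArg Subtype.val h
  simp only [Subring.coe_mul, SubmonoidClass.coe_pow, Subring.coe_add, AddSubgroupClass.coe_sub,
    NegMemClass.coe_neg] at h'
  exact h'

variable [hE : (curveOver K W).IsElliptic]

/-- `P(t) = P(t')` forces `t = t'` in `K`. [cite: SilvermanAEC2009, Prop. VII.2.2] -/
theorem coe_eq_of_ptOfZ_eq {t t' : (ballNilIdeal K).toIdeal} (h : ptOfZ K W t = ptOfZ K W t') :
    ((t : unitBall K) : K) = (t' : unitBall K) := by
  have := congrArg Affine.Point.zCoord h
  rwa [zCoord_ptOfZ, zCoord_ptOfZ] at this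

/-- **`P(t) + P(t) = P(F_W(t, t))`** (the tangent case, including the `2`-torsion sub-case `P(t) = −P(t)`, where
`t = i(t)` and `F(t, i(t)) = 0`). [cite: SilvermanAEC2009, Prop. VII.2.2] -/
theorem ptOfZ_add_self (t : (ballNilIdeal K).toIdeal) (ht0 : ((t : unitBall K) : K) ≠ 0) :
    ptOfZ K W t + ptOfZ K W t = ptOfZ K W (evF W t t) := by
  set X : K := evX W t with hXdef
  set s : K := ((t : unitBall K) : K) with hsdef
  by_cases hy : -X / s ^ 3 = (curveOver K W).toAffine.negY (X / s ^ 2) (-X / s ^ 3)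
  · -- `P(t) = -P(t)`: then `t = i(t)` and `F(t, t) = F(t, i(t)) = 0`
    have hneg : -ptOfZ K W t = ptOfZ K W t := by
      rw [ptOfZ_of_ne_zero ht0, Affine.Point.neg_some]
      simp only [Affine.Point.some.injEq]
      exact ⟨trivial, hy.symm⟩
    have hti : t = evalPt₁ (ballNilIdeal K) W.formalNeg W.constantCoeff_formalNeg t := by
      refine Subtype.ext (Subtype.ext (coe_eq_of_ptOfZ_eq (W := W) ?_))
      rw [← neg_ptOfZ, hneg]
    have hF0 : evF W t t = 0 := by
      conv_lhs => arg 3; rw [hti]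
      exact evF_formalNeg t
    rw [hF0, ptOfZ_zero]
    nth_rewrite 1 [← hneg]
    exact neg_add_cancel _
  -- the genuine tangent case
  have keyX := doubleX_at (W := W) t
  have keyY := doubleY_at (W := W) t
  have hXD' : evX W (evalPt₁ (ballNilIdeal K) (W.formalMul 2) (W.constantCoeff_formalMul 2) t) = evX W (evF W t t) := by
    rw [evF_self]
  rw [← coe_evF_self, hXD'] at keyX keyY
  set D : K := (((evF W t t : (ballNilIdeal K).toIdeal) : unitBall K) : K) with hDdef
  set XD : K := evX W (evF W t t) with hXDdef
  -- `Ỹ(t) = s³ (y − negY) ≠ 0`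
  set Yt : K := (cK K W.a₁ * s - 2) * X + cK K W.a₃ * s ^ 3 with hYtdef
  have hYte : Yt = s ^ 3 * (-X / s ^ 3 - (curveOver K W).toAffine.negY (X / s ^ 2) (-X / s ^ 3)) := by
    simp only [Affine.negY, (curveOver_a (K := K) (W := W)).1, (curveOver_a (K := K) (W := W)).2.2.1]
    exact formalYTilde_chart _ _ _ _ ht0
  have hYt0 : Yt ≠ 0 := by
    rw [hYte]; exact mul_ne_zero (pow_ne_zero 3 ht0) (sub_ne_zero.mpr hy)
  -- `D ≠ 0`
  have hD0 : D ≠ 0 := by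
    intro hD
    have hXD1 : XD = 1 := by
      have h1 := norm_evX_sub_one_le (W := W) (evF W t t)
      rw [← hDdef, hD, norm_zero] at h1
      exact sub_eq_zero.mp (norm_le_zero_iff.mp h1)
    rw [hD, hXD1] at keyX
    have : s ^ 2 * Yt ^ 2 = 0 := by linear_combination keyX
    simp only [mul_eq_zero, pow_eq_zero_iff, ne_eq, OfNat.ofNat_ne_zero, not_false_eq_true] at this
    rcases this with h | h
    · exact ht0 h
    · exact hYt0 h
  rw [ptOfZ_of_ne_zero ht0, ptOfZ_of_ne_zero hD0, Affine.Point.add_self_of_Y_ne hy]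
  simp only [Affine.Point.some.injEq]
  have hcX := chart_doubleX ht0 hD0 keyX
  have hcY := chart_doubleY ht0 hD0 keyY
  have htanX := tangent_addX_mul (curveOver K W) hy
  have htanY := tangent_addY_mul (curveOver K W) hy
  simp only [(curveOver_a (K := K) (W := W)).1, (curveOver_a (K := K) (W := W)).2.1,
    (curveOver_a (K := K) (W := W)).2.2.1, (curveOver_a (K := K) (W := W)).2.2.2.1, Affine.negY]
    at htanX htanY hcX hcY hy ⊢
  have hDy : -X / s ^ 3 - (-(-X / s ^ 3) - cK K W.a₁ * (X / s ^ 2) - cK K W.a₃) ≠ 0 := sub_ne_zero.mpr hy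
  have hX3 := mul_right_cancel₀ (pow_ne_zero 2 hDy) (htanX.trans hcX.symm)
  refine ⟨hX3, ?_⟩
  rw [hX3] at htanY
  have hY3 := mul_right_cancel₀ hDy (htanY.trans hcY.symm)
  linear_combination hY3

/-! ## §2 `P(u) + P(v) = P(F_W(u, v))` for all `u, v` -/

/-- **`P(u) + P(v) = P(F_W(u, v))` for all `u, v ∈ 𝔪_K`** (cases `u = 0`, `v = 0`, chord, tangent, `v = i(u)`).
[cite: SilvermanAEC2009, Prop. VII.2.2] -/
theorem ptOfZ_add (u v : (ballNilIdeal K).toIdeal) : ptOfZ K W u + ptOfZ K W v = ptOfZ K W (evF W u v) := by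
  by_cases hu0 : ((u : unitBall K) : K) = 0
  · obtain rfl : u = 0 := Subtype.ext (Subtype.ext hu0)
    rw [ptOfZ_zero, zero_add, evF_zero_left]
  by_cases hv0 : ((v : unitBall K) : K) = 0
  · obtain rfl : v = 0 := Subtype.ext (Subtype.ext hv0)
    rw [ptOfZ_zero, add_zero, evF_zero_right]
  by_cases hx : evX W u / ((u : unitBall K) : K) ^ 2 = evX W v / ((v : unitBall K) : K) ^ 2
  · rcases Affine.Y_eq_of_X_eq (equation_ptOfZ (W := W) u hu0) (equation_ptOfZ (W := W) v hv0) hx with hy | hy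
    · -- `P(v) = P(u)`: `v = u`, tangent case
      have huv : ((u : unitBall K) : K) = (v : unitBall K) := by
        refine coe_eq_of_ptOfZ_eq (W := W) ?_
        rw [ptOfZ_of_ne_zero hu0, ptOfZ_of_ne_zero hv0]
        simp only [Affine.Point.some.injEq]
        exact ⟨hx, hy⟩
      obtain rfl : u = v := Subtype.ext (Subtype.ext huv)
      exact ptOfZ_add_self u hu0
    · -- `P(v) = -P(u) = P(i(u))`: `v = i(u)`, `F(u, i(u)) = 0`
      have hvi : ((v : unitBall K) : K) =
          ((evalPt₁ (ballNilIdeal K) W.formalNeg W.constantCoeff_formalNeg u : (ballNilIdeal K).toIdeal) : unitBall K) := by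
        refine coe_eq_of_ptOfZ_eq (W := W) ?_
        rw [← neg_ptOfZ, ptOfZ_of_ne_zero hu0, ptOfZ_of_ne_zero hv0, Affine.Point.neg_some]
        simp only [Affine.Point.some.injEq]
        exact ⟨hx.symm, by rw [hy, ← hx, Affine.negY_negY]⟩
      obtain rfl : v = evalPt₁ (ballNilIdeal K) W.formalNeg W.constantCoeff_formalNeg u := Subtype.ext (Subtype.ext hvi)
      rw [← neg_ptOfZ, add_neg_cancel, evF_formalNeg, ptOfZ_zero]
  · exact ptOfZ_add_of_x_ne hu0 hv0 hx

/-- **The formal group law computes `E₁(K)`: `z(P + Q) = F_W(z(P), z(Q))`** for `P, Q ∈ E₁(K)`, over every complete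
ultrametric field `K` and every integral equation. [cite: SilvermanAEC2009, Prop. VII.2.2] -/
theorem zCoord_add {P Q : (curveOver K W).toAffine.Point}
    (hP : P ∈ kernel (NormedField.valuation (K := K)) (curveOver K W))
    (hQ : Q ∈ kernel (NormedField.valuation (K := K)) (curveOver K W)) :
    (P + Q).zCoord = (((evF W (zPt P hP) (zPt Q hQ) : (ballNilIdeal K).toIdeal) : unitBall K) : K) := by
  have h : P + Q = ptOfZ K W (evF W (zPt P hP) (zPt Q hQ)) := by
    rw [← ptOfZ_add]
    exact congrArg₂ (· + ·) (eq_ptOfZ_zPt hP) (eq_ptOfZ_zPt hQ)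
  rw [h, zCoord_ptOfZ]

/-! ## §3 The group isomorphism `Ŵ(𝔪_K) ≃ E₁(K)` -/

variable (K W) in
/-- **`t ↦ P(t)` as a group homomorphism `Ŵ(𝔪_K) = W.Pt (ballNilIdeal K) →+ E(K)`** (`ptOfZ_add`: the addition of
`Ŵ(𝔪_K)` is `F_W`). [cite: SilvermanAEC2009, Prop. VII.2.2] -/
def ptHom : W.Pt (ballNilIdeal K) →+ (curveOver K W).toAffine.Point where
  toFun P := ptOfZ K W P.val
  map_zero' := ptOfZ_zero
  map_add' P Q := by rw [WeierstrassCurve.Pt.val_add]; exact (ptOfZ_add P.val Q.val).symm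

/-- Unfolding `ptHom`. [cite: SilvermanAEC2009, Prop. VII.2.2] -/
@[simp] theorem ptHom_apply (P : W.Pt (ballNilIdeal K)) : ptHom K W P = ptOfZ K W P.val := rfl

/-- `ptHom` is injective. [cite: SilvermanAEC2009, Prop. VII.2.2] -/
theorem ptHom_injective : Function.Injective (ptHom K W) := fun _ _ h =>
  WeierstrassCurve.Pt.ext (ptOfZ_injective h)

/-- The image of `ptHom` is `E₁(K)`. [cite: SilvermanAEC2009, Prop. VII.2.2] -/
theorem range_ptHom : (ptHom K W).range = kernel (NormedField.valuation (K := K)) (curveOver K W) := by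
  ext P
  constructor
  · rintro ⟨Q, rfl⟩; exact ptOfZ_mem_kernel _
  · intro hP; exact ⟨⟨zPt P hP⟩, (eq_ptOfZ_zPt hP).symm⟩

variable (K W) in
/-- **`E₁(K) ≃+ Ŵ(𝔪_K)`**, `P ↦ z(P)`, with inverse `t ↦ P(t)` — Silverman AEC VII.2.2 for every complete ultrametric field
`K` and every `𝒪_K`-integral equation, the group structure on `𝔪_K` being that of `W.Pt (ballNilIdeal K)`.
[cite: SilvermanAEC2009, Prop. VII.2.2] -/
def kernelEquivPt : kernel (NormedField.valuation (K := K)) (curveOver K W) ≃+ W.Pt (ballNilIdeal K) :=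
  AddEquiv.symm
    { (ptHom K W).codRestrict (kernel (NormedField.valuation (K := K)) (curveOver K W)) (fun _ => ptOfZ_mem_kernel _) with
      invFun := fun P => ⟨zPt P.1 P.2⟩
      left_inv := fun P => WeierstrassCurve.Pt.ext (zPt_ptOfZ P.val)
      right_inv := fun P => Subtype.ext (eq_ptOfZ_zPt P.2).symm }

/-- Unfolding `kernelEquivPt`: the coordinate of the image is `z(P)`. [cite: SilvermanAEC2009, Prop. VII.2.2] -/
@[simp] theorem kernelEquivPt_apply_val (P : kernel (NormedField.valuation (K := K)) (curveOver K W)) :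
    (kernelEquivPt K W P).val = zPt P.1 P.2 := rfl

/-- Unfolding the inverse: `t ↦ P(t)`. [cite: SilvermanAEC2009, Prop. VII.2.2] -/
@[simp] theorem kernelEquivPt_symm_apply_coe (P : W.Pt (ballNilIdeal K)) :
    ((kernelEquivPt K W).symm P : (curveOver K W).toAffine.Point) = ptOfZ K W P.val := rfl

/-- **`z(n • P) = [n]_W(z(P))` on `E₁(K)`** (`n • P` computed in `E(K)`, `[n]_W = W.formalMul n` evaluated at `z(P)`):
the multiplication-by-`n` of the curve is the formal multiplication on the kernel of reduction.
[cite: SilvermanAEC2009, Prop. VII.2.2] -/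
theorem zPt_nsmul (n : ℕ) {P : (curveOver K W).toAffine.Point}
    (hP : P ∈ kernel (NormedField.valuation (K := K)) (curveOver K W)) :
    zPt (n • P) ((kernel (NormedField.valuation (K := K)) (curveOver K W)).nsmul_mem hP n) =
      evalPt₁ (ballNilIdeal K) (W.formalMul n) (W.constantCoeff_formalMul n) (zPt P hP) := by
  have h := congrArg WeierstrassCurve.Pt.val (map_nsmul (kernelEquivPt K W) n ⟨P, hP⟩)
  rw [WeierstrassCurve.Pt.val_nsmul, kernelEquivPt_apply_val] at h
  exact h

/-- `z`-coordinate form: `z(n • P) = [n]_W(z(P))` in `K`. [cite: SilvermanAEC2009, Prop. VII.2.2] -/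
theorem zCoord_nsmul (n : ℕ) {P : (curveOver K W).toAffine.Point}
    (hP : P ∈ kernel (NormedField.valuation (K := K)) (curveOver K W)) :
    (n • P).zCoord = ((evalAt (ballNilIdeal K) (zPt P hP) (W.formalMul n) : unitBall K) : K) := by
  have h := congrArg (fun t : (ballNilIdeal K).toIdeal => ((t : unitBall K) : K)) (zPt_nsmul n hP)
  exact h

end Literature.NumberTheory.EllipticCurves

end
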